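import Literature.MathematicalPhysics.KineticTheory.InfiniteChainObservables
import Mathlib.Probability.ProductMeasure
import Mathlib.Probability.Distributions.Gaussian.Real

/-!
# The radiating Gaussian state of the harmonic pinned chain (definitions)

Definitions for the HARMONIC TIGHTNESS WITNESS of the route items
`ParityLiouvilleSeed.LiouvilleForHeat` (`stmt-AtomisticToContinuum-13980`) and
`ParityLiouvilleSeed.ZeroCurrentRigidity` (`stmt-AtomisticToContinuum-12073`): an explicit
shift-invariant, time-invariant, translation-bounded, REGULAR probability measure of the harmonic
pinned chain `pinnedChain ω₂ 0 0 γ` with mean bond current `-1/2` (Spohn–Lebowitz 1977 prove that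
stationary current-carrying states of the harmonic crystal exist; this finite-range moving-average
field is an elementary instance). The proofs live in the helper files
`ParityLiouvilleSeedLiouvilleForHeatHarmonic*.lean`; only definitions and their immediate
`rfl` / measurability API live here.

* `Idx = ℤ × Fin 3`, `Src = Idx → ℝ`: three independent white noises `ξ = ζ(·,0)`, `η = ζ(·,1)`,
  `ζ' = ζ(·,2)` per site;
* `noiseVar ω₂ i`: variances `(1, ω₂, 1)`; `noiseMeasure ω₂`: the infinite product of the centred
  Gaussians `N(0, noiseVar ω₂ i)` over `Idx`;
* `gaussField : Src → ChainConfig`: `q_x = ξ_x`,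
  `p_x = (ξ_{x+1} - ξ_{x-1})/2 + η_x + (ζ'_x - 2ζ'_{x-1} + ζ'_{x-2})/2`;
* `harmonicState ω₂ = (noiseMeasure ω₂).map gaussField`;
* `idxShift : Idx ≃ Idx`, `(x, i) ↦ (x - 1, i)` (so that `ζ ∘ idxShift.symm` is the shifted noise).
-/

noncomputable section

open MeasureTheory ProbabilityTheory
open scoped NNReal
open Literature.MathematicalPhysics.KineticTheory.HeatConduction

namespace Summit.AtomisticToContinuum.FouriersLaw.Theorems.ParityLiouvilleSeed.HarmonicWitness

/-- Noise index: site `x ∈ ℤ` and species `i ∈ Fin 3` (`0`: position white noise `ξ`,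
`1`: momentum white noise `η` of variance `ω₂`, `2`: the second position-type white noise `ζ'`).
[folklore] -/
abbrev Idx : Type := ℤ × Fin 3

/-- Noise space. [folklore] -/
abbrev Src : Type := Idx → ℝ

/-- Variances of the three species: `(1, ω₂, 1)` (`ω₂.toNNReal`, so no sign hypothesis is needed
to state the definitions). [folklore] -/
def noiseVar (ω₂ : ℝ) (i : Fin 3) : ℝ≥0 := if i = 1 then ω₂.toNNReal else 1

/-- The noise law: independent centred Gaussians `N(0, noiseVar ω₂ i)` at every index `(x, i)`.
[folklore] -/
def noiseMeasure (ω₂ : ℝ) : Measure Src :=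
  Measure.infinitePi fun k : Idx => gaussianReal 0 (noiseVar ω₂ k.2)

/-- The noise law is a probability measure. [folklore] -/
instance (ω₂ : ℝ) : IsProbabilityMeasure (noiseMeasure ω₂) := by
  unfold noiseMeasure; infer_instance

/-- The momentum coordinate of the field at site `x` as a function of the noise:
`p_x = (ξ_{x+1} - ξ_{x-1})/2 + η_x + (ζ'_x - 2ζ'_{x-1} + ζ'_{x-2})/2`. [folklore] -/
def gaussFieldP (ζ : Src) (x : ℤ) : ℝ :=
  (ζ (x + 1, 0) - ζ (x - 1, 0)) / 2 + ζ (x, 1) + (ζ (x, 2) - 2 * ζ (x - 1, 2) + ζ (x - 2, 2)) / 2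

/-- The field map: `q_x = ξ_x`, `p_x = gaussFieldP ζ x`. [folklore] -/
def gaussField (ζ : Src) : ChainConfig := fun x => (ζ (x, 0), gaussFieldP ζ x)

/-- **The radiating Gaussian state of the harmonic pinned chain** (pinning frequency² `ω₂`): the
law of the field `gaussField` under the noise. [folklore] -/
def harmonicState (ω₂ : ℝ) : Measure ChainConfig := (noiseMeasure ω₂).map gaussField

/-- The index shift `(x, i) ↦ (x - 1, i)`; its inverse `(x, i) ↦ (x + 1, i)` realises the lattice
shift on the noise. [folklore] -/
def idxShift : Idx ≃ Idx where
  toFun k := (k.1 - 1, k.2)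
  invFun k := (k.1 + 1, k.2)
  left_inv k := by simp
  right_inv k := by simp

/-! ### Immediate API -/

/-- Position coordinate of the field. [folklore] -/
@[simp] theorem gaussField_apply_fst (ζ : Src) (x : ℤ) : (gaussField ζ x).1 = ζ (x, 0) := rfl

/-- Momentum coordinate of the field. [folklore] -/
@[simp] theorem gaussField_apply_snd (ζ : Src) (x : ℤ) : (gaussField ζ x).2 = gaussFieldP ζ x := rfl

/-- `idxShift.symm (x, i) = (x + 1, i)`. [folklore] -/
@[simp] theorem idxShift_symm_apply (k : Idx) : idxShift.symm k = (k.1 + 1, k.2) := rfl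

/-- `idxShift (x, i) = (x - 1, i)`. [folklore] -/
@[simp] theorem idxShift_apply (k : Idx) : idxShift k = (k.1 - 1, k.2) := rfl

/-- `gaussFieldP` is measurable in the noise. [folklore] -/
@[fun_prop]
theorem measurable_gaussFieldP (x : ℤ) : Measurable fun ζ : Src => gaussFieldP ζ x := by
  unfold gaussFieldP; fun_prop

/-- `gaussFieldP` is continuous in the noise. [folklore] -/
@[fun_prop]
theorem continuous_gaussFieldP (x : ℤ) : Continuous fun ζ : Src => gaussFieldP ζ x := by
  unfold gaussFieldP; fun_prop

/-- The field map is measurable. [folklore] -/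
@[fun_prop]
theorem measurable_gaussField : Measurable gaussField := by
  refine measurable_pi_iff.mpr fun x => ?_
  exact (measurable_pi_apply _).prodMk (measurable_gaussFieldP x)

/-- The field map is continuous. [folklore] -/
@[fun_prop]
theorem continuous_gaussField : Continuous gaussField := by
  refine continuous_pi fun x => ?_
  exact (continuous_apply _).prodMk (continuous_gaussFieldP x)

/-- The radiating Gaussian state is a probability measure. [folklore] -/
instance (ω₂ : ℝ) : IsProbabilityMeasure (harmonicState ω₂) :=
  Measure.isProbabilityMeasure_map measurable_gaussField.aemeasurable

/-- The field intertwines the noise shift with the lattice shift: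
`gaussField (ζ ∘ idxShift.symm) = shift (gaussField ζ)`. [folklore] -/
theorem gaussField_comp_idxShift_symm (ζ : Src) : gaussField (ζ ∘ idxShift.symm) = shift (gaussField ζ) := by
  funext x
  simp only [gaussField, gaussFieldP, shift, Function.comp_apply, idxShift_symm_apply]
  refine Prod.ext rfl ?_
  show (ζ (x + 1 + 1, 0) - ζ (x - 1 + 1, 0)) / 2 + ζ (x + 1, 1) +
      (ζ (x + 1, 2) - 2 * ζ (x - 1 + 1, 2) + ζ (x - 2 + 1, 2)) / 2 =
    (ζ (x + 1 + 1, 0) - ζ (x + 1 - 1, 0)) / 2 + ζ (x + 1, 1) +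
      (ζ (x + 1, 2) - 2 * ζ (x + 1 - 1, 2) + ζ (x + 1 - 2, 2)) / 2
  have h1 : x - 1 + 1 = x + 1 - 1 := by ring
  have h2 : x - 2 + 1 = x + 1 - 2 := by ring
  rw [h1, h2]

/-- Integration against the state is integration of `F ∘ gaussField` against the noise. [folklore] -/
theorem integral_harmonicState (ω₂ : ℝ) {F : ChainConfig → ℝ} (hF : AEStronglyMeasurable F (harmonicState ω₂)) :
    ∫ σ, F σ ∂harmonicState ω₂ = ∫ ζ, F (gaussField ζ) ∂noiseMeasure ω₂ :=
  integral_map measurable_gaussField.aemeasurable hF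

/-- Integrability against the state is integrability of `F ∘ gaussField` against the noise. [folklore] -/
theorem integrable_harmonicState_iff (ω₂ : ℝ) {F : ChainConfig → ℝ}
    (hF : AEStronglyMeasurable F (harmonicState ω₂)) :
    Integrable F (harmonicState ω₂) ↔ Integrable (F ∘ gaussField) (noiseMeasure ω₂) :=
  integrable_map_measure hF measurable_gaussField.aemeasurable

end Summit.AtomisticToContinuum.FouriersLaw.Theorems.ParityLiouvilleSeed.HarmonicWitness

end
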